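import Summits.BirchSwinnertonDyer.Rank1Residual.X11b.Three.LambdaSupplyPadicUnits
import Mathlib.Algebra.CharP.Lemmas
import HarnessLib

/-!
# Class X11b, route p2 at a GENERAL prime `p`: the λ-supply toolkit, part (D-I)′ — `p`-power torsion
# of principal units and the prime-to-`p` exponent of a compact image (x11b3 S24-a (D-I) at every `p`)

HONEST FRAMING (cell `b2b-bsdres`, run/shared/lean/b2b/bsd-rank1-residual/, verbatim in every
file): the goal of the cell is to DELETE the COMBINATION-SHAPED residual classes of the
Birch–Swinnerton-Dyer formula for ALL analytic-rank `≤ 1` elliptic curves over `ℚ` — "full BSD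
formula for every rank `≤ 1` curve in class `C`" assembled STRICTLY from published theorems — so
that the rank-`≤ 1` remainder becomes exactly the CONSTRUCTION-SHAPED classes, which are TYPED
(missing-input `Prop`s), NOT attempted. This is not "finishing BSD". Sub-cell `multr1-p2` is a
RESEARCH ROUTE on class X11b (`ClassX11b W p := r_an = 1 ∧ p ≠ 2 ∧ mult(p) ∧ irr(p)`); no claim
beyond the stated class and loci; X11b's label does not change; NOTHING is booked by this file.

THEOREMS ONLY (elementary `p`-adic analysis; no definition, no named fact, no `sorry`).

PROVENANCE / CREDIT: this is the every-`p` form of team x11b3's S24-a part (D-I)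
(`X11b/Three/LambdaSupplyPadicUnits.lean`, seat `b2b-bsdres-x11b3-p7`, p261278), whose two
`p = 3` statements `norm_one_sub_lt_of_pow_three` and `exists_pow_mem_principalUnits_coprime_three`
carry `-- TODO(general form): every prime p`. Everything else of that file (`exists_principalUnits`,
`eq_one_of_pow_eq_one_of_coprime`, `norm_apply_eq_one`, `exists_pow_mem_of_isOpen`, …) is already
stated at a general prime and is IMPORTED, not restated. Purpose (route p2, gen 25): the λ-supply
hypothesis `hsup` of `P2.exists_isBDPLFunctionInt_of_hsieh2014` (conjunct 3.1♭ of route p2's open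
input H∃♭ from Hsieh 2014 Thm. 1) is x11b3's S24-a statement AT THE PRIME `p`; x11b3 proved it at
`p = 3` (`Three.lambdaSupplyAt₃`, p264661); the port to every odd prime starts here.

## What this file proves (setting: `F` a normed field and normed `ℚ_p`-algebra with ultrametric
## distance — x11b3's receptacle-style setting, `P` any subgroup with `u ∈ P ↔ ‖1 - u‖ < 1`)

* `norm_one_sub_lt_of_pow_prime_pow`: **`p`-power torsion of `Fˣ/P` is trivial on units** — if
  `‖x‖ = 1` and `‖1 - x^{p^b}‖ < 1` then `‖1 - x‖ < 1`. Proof (freshman's dream with remainder,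
  Mathlib `add_pow_prime_pow_eq'`): `1 = ((1-x) + x)^{p^b} = (1-x)^{p^b} + x^{p^b} + p·S` with
  `‖S‖ ≤ 1`, so `‖1 - x‖^{p^b} = ‖(1 - x^{p^b}) - p·S‖ < 1`.
* `norm_one_sub_lt_of_pow_prime`: the case `b = 1`.
* `exists_pow_mem_principalUnits_coprime`: for a continuous homomorphism `g : G → Fˣ` from a
  compact group there is `T ≥ 1` PRIME TO `p` with every `g(σ)^T ∈ P` (the index of `g⁻¹(P)` is
  `p^a·T`; strip `p^a` by the first lemma).

## References

* [Serre1973] J.-P. Serre, *A Course in Arithmetic*, Ch. II §3.1 (units of a `p`-adic field,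
  principal units `U₁`; `U/U₁` is the prime-to-`p` roots of unity).
* [Washington1997] L. C. Washington, *Introduction to Cyclotomic Fields*, §5.1.
-/

noncomputable section

open Filter Topology

namespace Summit.BirchSwinnertonDyer.Rank1Residual.X11b.LambdaSupply.PadicUnits

open Literature.NumberTheory.Transcendental Literature.NumberTheory.Transcendental.IwasawaLog
open Summit.BirchSwinnertonDyer.Rank1Residual.X11b.Three.LambdaSupply.PadicUnits

variable {p : ℕ} [Fact p.Prime] {F : Type*} [NormedField F] [instF : NormedAlgebra ℚ_[p] F]
  [IsUltrametricDist F]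

/-! ### §1. `p`-power torsion modulo principal units -/

include instF in
/-- **A unit whose `p^b`-th power is principal is principal**: `‖x‖ = 1`, `‖1 - x^{p^b}‖ < 1` ⟹
`‖1 - x‖ < 1`. Freshman's dream with remainder: `1 = ((1 - x) + x)^{p^b} = (1-x)^{p^b} + x^{p^b} + p·S`
where `S` is a sum of products of powers of `1 - x`, `x` and natural numbers, so `‖S‖ ≤ 1` and
`‖1 - x‖^{p^b} = ‖(1 - x^{p^b}) - p·S‖ < 1`. (The residue-field statement: Frobenius is injective.)
[cite: Serre1973, Ch. II §3.1] -/
theorem norm_one_sub_lt_of_pow_prime_pow {x : F} (hx : ‖x‖ = 1) (b : ℕ)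
    (h : ‖1 - x ^ p ^ b‖ < 1) : ‖1 - x‖ < 1 := by
  have hp : p.Prime := Fact.out
  -- `‖1 - x‖ ≤ 1`
  have h1x : ‖1 - x‖ ≤ 1 := by
    have h' := IsUltrametricDist.norm_add_le_max (1 : F) (-x)
    rwa [← sub_eq_add_neg, norm_neg, norm_one, hx, max_self] at h'
  -- the remainder `S` and its norm
  set S : F := ∑ k ∈ Finset.Ioo 0 (p ^ b),
    (1 - x) ^ k * x ^ (p ^ b - k) * (((p ^ b).choose k / p : ℕ) : F) with hS
  have hSle : ‖S‖ ≤ 1 := by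
    refine IsUltrametricDist.norm_sum_le_of_forall_le_of_nonneg zero_le_one fun k _ => ?_
    rw [norm_mul, norm_mul, norm_pow, norm_pow, hx, one_pow, mul_one]
    exact mul_le_one₀ (pow_le_one₀ (norm_nonneg _) h1x) (norm_nonneg _) (norm_natCast_le_one p _)
  have hpS : ‖(p : F) * S‖ < 1 := by
    rw [norm_mul]
    exact mul_lt_one_of_nonneg_of_lt_one_left (norm_nonneg _) norm_prime_lt_one hSle
  -- freshman's dream: `1 = (1-x)^{p^b} + x^{p^b} + p S`
  have key := add_pow_prime_pow_eq' hp (1 - x) x b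
  rw [sub_add_cancel, one_pow] at key
  have heq : (1 - x) ^ p ^ b = (1 - x ^ p ^ b) - p * S := by
    rw [hS]; linear_combination -key
  have hlt : ‖1 - x‖ ^ p ^ b < 1 := by
    rw [← norm_pow, heq, sub_eq_add_neg]
    refine lt_of_le_of_lt (IsUltrametricDist.norm_add_le_max _ _) (max_lt h ?_)
    rwa [norm_neg]
  exact (pow_lt_one_iff_of_nonneg (norm_nonneg _) (pow_ne_zero _ hp.ne_zero)).mp hlt

include instF in
/-- **`x^p` principal ⟹ `x` principal** (the case `b = 1` of `norm_one_sub_lt_of_pow_prime_pow`;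
every-`p` form of x11b3's `norm_one_sub_lt_of_pow_three`). [cite: Serre1973, Ch. II §3.1] -/
theorem norm_one_sub_lt_of_pow_prime {x : F} (hx : ‖x‖ = 1) (h : ‖1 - x ^ p‖ < 1) :
    ‖1 - x‖ < 1 :=
  norm_one_sub_lt_of_pow_prime_pow hx 1 (by rwa [pow_one])

/-! ### §2. Stripping the `p`-part of the exponent of a compact image -/

include instF in
/-- **Prime-to-`p` exponent into the principal units**: for a continuous homomorphism `g : G → Fˣ`
from a compact group there is `T ≥ 1` PRIME TO `p` with every `g(σ)^T` a principal unit
(`g(σ)^{p^a T}` is principal for the index `p^a T` of the open subgroup `g⁻¹(P)`, and `g(σ)^T` is a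
unit, so `norm_one_sub_lt_of_pow_prime_pow` strips `p^a`). Every-`p` form of x11b3's
`exists_pow_mem_principalUnits_coprime_three`. [cite: Serre1973, Ch. II §3.1] -/
theorem exists_pow_mem_principalUnits_coprime {G : Type*} [Group G] [TopologicalSpace G]
    [CompactSpace G] [IsTopologicalGroup G] (g : G →* Fˣ) (hg : Continuous g) (P : Subgroup Fˣ)
    (hP : ∀ u : Fˣ, u ∈ P ↔ ‖1 - (u : F)‖ < 1) :
    ∃ T : ℕ, 0 < T ∧ Nat.Coprime p T ∧ ∀ σ : G, (g σ) ^ T ∈ P := by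
  have hp : p.Prime := Fact.out
  have hPopen : IsOpen (P : Set Fˣ) := by
    have : (P : Set Fˣ) = {u : Fˣ | ‖1 - (u : F)‖ < 1} := Set.ext fun u => hP u
    rw [this]
    exact isOpen_setOf_norm_one_sub_lt
  obtain ⟨n, hn, hmem⟩ := exists_pow_mem_of_isOpen g hg P hPopen
  -- `n = p^a T` with `p ∤ T`
  obtain ⟨a, T, hTp, rfl⟩ := Nat.exists_eq_pow_mul_and_not_dvd hn.ne' p hp.ne_one
  have hT : 0 < T := Nat.pos_of_ne_zero fun h => by simp [h] at hn
  refine ⟨T, hT, (Nat.Prime.coprime_iff_not_dvd hp).mpr hTp, fun σ => ?_⟩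
  rw [hP, Units.val_pow_eq_pow_val]
  refine norm_one_sub_lt_of_pow_prime_pow (p := p) ?_ a ?_
  · rw [norm_pow, norm_apply_eq_one g hg σ, one_pow]
  · have h := hmem σ
    rw [hP, Units.val_pow_eq_pow_val] at h
    rwa [← pow_mul, mul_comm]

end Summit.BirchSwinnertonDyer.Rank1Residual.X11b.LambdaSupply.PadicUnits

end
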